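import Summits.Ventures.QEC.Census.BB.A1s_n168_k18_7144a1e2.CoverWitZ1
import Summits.Ventures.QEC.Census.BB.A1s_n168_k18_7144a1e2.CoverWitZ2
import Summits.Ventures.QEC.Census.BB.A1s_n168_k18_7144a1e2.Cert
import HarnessLib

/-!
# Census row `A1s_n168_k18_7144a1e2` (`[[168,18,8]]`): the LABEL COVER by translations, witnessed and chunked, tier KERNEL — part 1/4 (chunks 0…1; also `cols_ok` / `Ws_ok` / `taus_ok`)
# (qec-search-10 g4: the one-file form p520581 exceeded the gate's 600 s elaboration budget with 11 chunks ⇒ ≤ 3 chunks per file; glued in `CoverZ.lean`)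

C5 with automorphisms for `k = 18` (262143 nonzero labels, 59 representative blocks, 20 listed translations `A1s_n168_k18_7144a1e2.taus`), in the
table form of `Census/OrbitBZCoverWit2.lean`: `cols_ok` / `Ws_ok` tie the emitted tables `A1s_n168_k18_7144a1e2.coverTabZ` to type-12's `rhoCols` and to the
blocks' label bases (one `decide +kernel` each), one `coverAutTabWitOK … = true` theorem per chunk of ≤ 24576 labels checks every label's
packed witness (translation, block, combination) by ONE comparison of two XORs of ≤ 18 small words, and `coverAll : CoverSpan … 1 (2^18)`
(chunks glued by `CoverSpan.append`) is the input of `coverAutTab2_hcover` (= the `hcover` hypothesis of type-10's `bzAut_lower_sound`,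
used by `Distance.lean`). The monolithic `coverAutTabOK` is not affordable at k ≥ 14 (measured). Statements name `A1s_n168_k18_7144a1e2.*` explicitly.
-/

set_option Elab.async false

namespace Summit.Ventures.QEC.Census.A1s_n168_k18_7144a1e2

open Summit.Ventures.QEC.Census

set_option maxHeartbeats 4000000 in
/-- The emitted label-action columns ARE type-12's `rhoCols` of the listed translations (KERNEL). -/
theorem cols_ok : A1s_n168_k18_7144a1e2.taus.map (fun t => rhoCols 4 21 A1s_n168_k18_7144a1e2.bzAutData.LX A1s_n168_k18_7144a1e2.bzAutData.LZ t) = A1s_n168_k18_7144a1e2.coverTabZ.cols := by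
  decide +kernel

/-- The emitted label bases ARE the blocks' `W` (KERNEL). -/
theorem Ws_ok : A1s_n168_k18_7144a1e2.bzAutData.sideZ.blocks.map BZBlock.W = A1s_n168_k18_7144a1e2.coverTabZ.Ws := by
  decide +kernel

/-- The listed translations are in range (`t₁ < 4`, `t₂ < 21`). -/
theorem taus_ok : (A1s_n168_k18_7144a1e2.taus.all fun t => decide (t.1 < 4) && decide (t.2 < 21)) = true := by
  decide

set_option maxHeartbeats 4000000 in
/-- Labels `[1, 24577)` are covered (each by its witnessed block / translation; KERNEL, 24576 one-line checks, split depth 6). -/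
theorem covZ_0 : coverAutTabWitOK A1s_n168_k18_7144a1e2.coverTabZ 21 59 6 1 24576 A1s_n168_k18_7144a1e2.witsZ_0 = true := by
  decide +kernel

set_option maxHeartbeats 4000000 in
/-- Labels `[24577, 49153)` are covered (each by its witnessed block / translation; KERNEL, 24576 one-line checks, split depth 6). -/
theorem covZ_1 : coverAutTabWitOK A1s_n168_k18_7144a1e2.coverTabZ 21 59 6 24577 24576 A1s_n168_k18_7144a1e2.witsZ_1 = true := by
  decide +kernel

end Summit.Ventures.QEC.Census.A1s_n168_k18_7144a1e2
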